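import Summits.Ventures.YMGap.FlowData.RectTubeVacuumSector
import Summits.Ventures.YMGap.FlowData.TubeFluxGap
import HarnessLib

/-!
# Venture YMGap, track Y3 FLOW-DATA — rectangular cross-sections: every non-trivial centre flux costs energy,
# `‖T ∘ P_e‖ < ‖T‖`, `E_e > 0` (v2 twin of `TubeFluxGap`; theorems only)

HONEST FRAMING: venture file of the cell `pub-ymgap` (QuantumFields programme), track Y3; companion THEOREMS for
`FlowData/RectTubeTransferOperator.lean` (lead R237 (c) v2; the `2×3`, `2×4` tubes).  Same statements and proofs
as `FlowData/TubeFluxGap.lean`: Jentzsch's gap below the twist-invariant ground state gives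
`rectTubeSectorNorm_lt_norm` and `rectTubeFluxEnergy_pos` (`e ≠ 0`, sector not annihilated), hence
`su2RectTorelonEnergy_pos`.  Finite-volume spectral statements; not confinement, nothing about `L → ∞`.

References: M. Reed, B. Simon IV (1978) Thm. XIII.43–44 [cite: ReedSimonIV1978, §XIII.12]; G. 't Hooft, Nucl. Phys.
B 153 (1979) 141 [cite: tHooft1979Flux].
-/

noncomputable section

open scoped BigOperators ENNReal
open MeasureTheory Filter Function
open Literature.MathematicalPhysics.QuantumFieldTheory Literature.Analysis.OperatorTheory
open Literature.MathematicalPhysics.QuantumLattice (RectTorusSite)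

namespace Summit.Ventures.YMGap.FlowData

section Gap

variable {G : Type*} [Group G] [TopologicalSpace G] [IsTopologicalGroup G] [CompactSpace G]
  [MeasurableSpace G] [BorelSpace G] [SecondCountableTopology G] {n : ℕ} (ρ : G →* Matrix (Fin n) (Fin n) ℂ)
  (J : ℝ) {k : ℕ} {Ls : Fin k → ℕ} [∀ i, NeZero (Ls i)]

/-- **Non-trivial flux sectors lie strictly below the vacuum**: `‖T ∘ P_e‖ < ‖T‖` for `e ≠ 0`, central involution
`z`, continuous unitary `ρ` (the range of `P_e` is orthogonal to the twist-invariant ground state, on whose orthogonal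
complement `T` has norm `θ < ‖T‖` by Jentzsch's gap). [cite: ReedSimonIV1978, §XIII.12] -/
theorem rectTubeSectorNorm_lt_norm (hρ : Continuous ρ) (hρu : ∀ g, ρ g ∈ Matrix.unitaryGroup (Fin n) ℂ) {z : G}
    (hz : z ∈ Subgroup.center G) (hz2 : z * z = 1) {e : Fin k → ZMod 2} (he : e ≠ 0) :
    rectTubeSectorNorm ρ z J Ls e < ‖rectTubeTransferOperator ρ J Ls‖ := by
  set T := rectTubeTransferOperator ρ J Ls with hT
  obtain ⟨φ₀, h1, hpos, heig, hsimple, θ, hθ0, hθlt, hgap⟩ :=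
    (isPositivityImproving_rectTubeTransferOperator J Ls hρ).exists_spectralGap
      (isSelfAdjoint_rectTubeTransferOperator J Ls hρ hρu) (isCompactOperator_rectTubeTransferOperator J Ls hρ)
      (norm_pos_iff.1 (norm_rectTubeTransferOperator_pos J Ls hρ))
  -- the vacuum of `exists_vacuum` is a multiple of `φ₀`, so `φ₀` itself is twist invariant up to that scalar;
  -- we only need `P_e φ₀ = 0`, which follows from `P_e ψ₀ = 0` for the twist-invariant unit vacuum `ψ₀ = c φ₀`.
  obtain ⟨ψ₀, hψ1, -, hψeig, -, hψinv⟩ := exists_rectVacuum ρ J hρ hρu hz (Ls := Ls)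
  have hψφ : ψ₀ = (@inner ℝ _ _ φ₀ ψ₀) • φ₀ := hsimple ψ₀ hψeig
  have hc : @inner ℝ _ _ φ₀ ψ₀ ≠ 0 := by
    intro h0
    rw [h0, zero_smul] at hψφ
    rw [hψφ, norm_zero] at hψ1
    exact zero_ne_one hψ1
  have hPψ : rectTubeFluxProjection z Ls e ψ₀ = 0 := by
    rw [rectTubeFluxProjection_apply_of_invariant z hψinv, if_neg he]
  have hPφ : rectTubeFluxProjection z Ls e φ₀ = 0 := by
    have h := hPψ
    rw [hψφ, map_smul, smul_eq_zero] at h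
    exact h.resolve_left hc
  -- every `P_e ψ` is orthogonal to `φ₀` (self-adjointness of `P_e`)
  have hsa := isSelfAdjoint_rectTubeFluxProjection (Ls := Ls) z hz2 e
  have horth : ∀ ψ, @inner ℝ _ _ φ₀ (rectTubeFluxProjection z Ls e ψ) = 0 := by
    intro ψ
    have h := (ContinuousLinearMap.isSelfAdjoint_iff_isSymmetric.1 hsa) φ₀ ψ
    change @inner ℝ _ _ (rectTubeFluxProjection z Ls e φ₀) ψ = @inner ℝ _ _ φ₀ (rectTubeFluxProjection z Ls e ψ) at h
    rw [← h, hPφ, inner_zero_left]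
  -- hence `‖T P_e ψ‖ ≤ θ ‖P_e ψ‖ ≤ θ ‖ψ‖`
  have hbound : ‖T.comp (rectTubeFluxProjection z Ls e)‖ ≤ θ := by
    refine ContinuousLinearMap.opNorm_le_bound _ hθ0 fun ψ => ?_
    rw [ContinuousLinearMap.comp_apply]
    calc ‖T (rectTubeFluxProjection z Ls e ψ)‖ ≤ θ * ‖rectTubeFluxProjection z Ls e ψ‖ := hgap _ (horth ψ)
      _ ≤ θ * (‖rectTubeFluxProjection z Ls e‖ * ‖ψ‖) :=
          mul_le_mul_of_nonneg_left ((rectTubeFluxProjection z Ls e).le_opNorm ψ) hθ0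
      _ ≤ θ * (1 * ‖ψ‖) := mul_le_mul_of_nonneg_left
          (mul_le_mul_of_nonneg_right (norm_fluxProjection_le_one (fun s => norm_rectFluxTwistOp_le_one (Ls := Ls) z s) e) (norm_nonneg _)) hθ0
      _ = θ * ‖ψ‖ := by rw [one_mul]
  exact lt_of_le_of_lt hbound hθlt

/-- **Every non-trivial flux costs energy on a finite tube: `E_e > 0`** for `e ≠ 0`, whenever the sector is not
annihilated (`0 < ‖T ∘ P_e‖`); central involution `z`, continuous unitary `ρ`. A finite-volume spectral statement,
not confinement. [cite: ReedSimonIV1978, §XIII.12] -/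
theorem rectTubeFluxEnergy_pos (hρ : Continuous ρ) (hρu : ∀ g, ρ g ∈ Matrix.unitaryGroup (Fin n) ℂ) {z : G}
    (hz : z ∈ Subgroup.center G) (hz2 : z * z = 1) {e : Fin k → ZMod 2} (he : e ≠ 0)
    (hpos : 0 < rectTubeSectorNorm ρ z J Ls e) : 0 < rectTubeFluxEnergy ρ z J Ls e := by
  unfold rectTubeFluxEnergy fluxEnergy
  exact sub_pos.2 (Real.log_lt_log hpos (rectTubeSectorNorm_lt_norm ρ J hρ hρu hz hz2 he))

/-- **The cell's torelon energy on a rectangular cross-section is strictly positive**: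
`0 < su2RectTorelonEnergy β Ls μ` for every real `β`, whenever the flux sector along `μ` is not annihilated. Finite
volume only. [folklore] -/
theorem su2RectTorelonEnergy_pos (β : ℝ) (Ls : Fin k → ℕ) [∀ i, NeZero (Ls i)] (μ : Fin k)
    (hpos : 0 < su2RectSectorTop β Ls μ) : 0 < su2RectTorelonEnergy β Ls μ := by
  haveI : SecondCountableTopology (Matrix.specialUnitaryGroup (Fin 2) ℂ) :=
    Literature.MathematicalPhysics.QuantumLattice.secondCountableTopology_su2
  exact rectTubeFluxEnergy_pos (Literature.MathematicalPhysics.QuantumLattice.fundamentalRep (Fin 2)) (β / 2)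
    (Literature.MathematicalPhysics.QuantumLattice.continuous_fundamentalRep (Fin 2))
    Literature.MathematicalPhysics.QuantumLattice.fundamentalRep_mem_unitaryGroup su2MinusOne_mem_center
    su2MinusOne_mul_self (single_one_ne_zero μ) hpos

end Gap

end Summit.Ventures.YMGap.FlowData
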